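import Literature.MathematicalPhysics.QuantumFieldTheory.Balaban1983to89.B9Eq3115KnitLetterYNumerics
import Literature.MathematicalPhysics.QuantumFieldTheory.Balaban1983to89.B7Prop5CplxLevels
import Literature.MathematicalPhysics.QuantumFieldTheory.Balaban1983to89.B7Prop3Flat

/-!
# Balaban UV-stability nodes, N06 [B9] Sect. B — «K2-G-WINDOW»: THE JOINT x-FREE NUMERICS WINDOW OF THE KNIT SECT.-B STEP IS NON-EMPTY

[B9] = T. Bałaban, *Propagators for lattice gauge theories in a background field*, Commun. Math. Phys. **99** (1985) 389–434 [`Balaban1985BackgroundPropagators`];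
[B8] = T. Bałaban, *Averaging operations for lattice gauge theories*, Commun. Math. Phys. **98** (1985) 17–51 [`Balaban1985Averaging`].

statement-level skeleton of published theorems with citation tags; proofs where landed; nothing here is a claim about the Yang–Mills mass gap

THE PRINT.  p. 409: *«α₀ so small that O(1)Mα₀ is still sufficiently small»*; [B8] Prop. 2 p. 26, Prop. 5 p. 42, Prop. 7 p. 43 (the smallness windows of the averaging constants).

WHAT (seat dag-n06-c gen 26).  The knit Sect.-B step of record (`N06SectBStepUParKnitRecord.sectBStepUPar_knitRecord`, ✓) and the knit class's `hclass`
(`N06SectBClassKnitHclass.hclass_C37KY_knit`) display x-free numerics: the knit-letter window `α₀′` (`α₀′ ≦ α_Q`, `C₀α₀′ ≦ 1∕3`, `4α₀′, 8α₀′ ≦ c₂′`, `K_pl(a)·L⁴ < α₀′` on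
`a ≦ a₁`), dag-n06-l's [B8]-Prop.-7 window `ϱ′ ∕ ϱ` of `B9Eq380QknitVariationY` (`hsmall' hc₃' hϱ'1 hE hdX hsmall hc₃`), and the (K1) cap window `αK` of
`B9Eq358KnitTransporterVariationY` (`hsmall hc₃ hsm` — met by `αK := ϱ′` once `4096(d+1)ϱ′ ≦ 1`).  THIS FILE proves they are JOINTLY SATISFIABLE: ★★ `knitSectBWindow_inhabited`
exhibits `(α₀′, a₁, ϱ′, ϱ)` meeting all of them at once (the `α₀′` block from dag-n06-l's `B9Eq3115KnitLetterYNumerics.knitWindow_inhabited_le` at a smaller `amax`; `ϱ′`, `ϱ` as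
explicit minima; the exponentials through `Real.abs_exp_sub_one_le`: `e^x ≦ 5∕4` for `0 ≦ x ≦ 1∕8`).

EDITION 2 (gen 27, «K2-G-KNIT-N», APPEND-ONLY §3): `knitSectBWindow_inhabited_le` (the same window below any cap `amax₀`) and ★★ `knitSectBWindow_inhabited_N` (the window
WITH dag-n06-l's two `N`-windows `32((d+1)+1)((d+1)+4)(ℓ+1)²α₀′ ≦ 1∕4`, `N·(…) < π` of `parKnitY_mem_SU_of_reg335P` — the displays of the `N`-cap-free knit Sect.-B
step `…KnitRecordN` — for EVERY `N`).

HONEST SCOPE.  Real-number bookkeeping only; no statement of [B9] ∕ [B8] asserted; count-neutral; NOT the discharge of any N06 obligation; nothing continuum ∕ OS ∕ mass gap ∕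
Clay.  Cell `pub-ymgap` (HUMAN RULING D-0062), Track A node N06 [B9], 2026-08-30.
-/

noncomputable section

namespace Summit.QuantumFields.YangMills.BalabanUVNodes.N06SectBKnitWindow

open Literature.MathematicalPhysics.QuantumFieldTheory.Balaban1983to89
open Literature.MathematicalPhysics.QuantumFieldTheory.Balaban1983to89.B6KLevelCensusIndexV1 (KIdx kGeo)
open Literature.MathematicalPhysics.QuantumFieldTheory.Balaban1983to89.B7Prop2Explicit (C0 c2' c2'_pos)
open Literature.MathematicalPhysics.QuantumFieldTheory.Balaban1983to89.B7Prop3Flat (c3 c3_pos)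
open Literature.MathematicalPhysics.QuantumFieldTheory.Balaban1983to89.B7Prop5CplxLevels (epsCplx tauCplx epsCplx_nonneg)
open Literature.MathematicalPhysics.QuantumFieldTheory.Balaban1983to89.B9Eq316AveragingTransposeZd (alphaQ)
open Literature.MathematicalPhysics.QuantumFieldTheory.Balaban1983to89.B9C2FormBoxRegimeY (Kpl)
open Literature.MathematicalPhysics.QuantumFieldTheory.Balaban1983to89.B9Eq3115KnitLetterYNumerics (knitWindow_inhabited_le)

/-! ## §1 Elementary bounds -/

/-- `e^x ≦ 5∕4` for `0 ≦ x ≦ 1∕8` (`|e^x − 1| ≦ 2|x|` on `|x| ≦ 1`). [cite: Balaban1985Averaging, Prop. 7 p.43, bookkeeping] -/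
theorem exp_le_five_fourths {x : ℝ} (h0 : 0 ≤ x) (h : x ≤ 1 / 8) : Real.exp x ≤ 5 / 4 := by
  have h1 : |x| ≤ 1 := by rw [abs_of_nonneg h0]; linarith
  have h2 := Real.abs_exp_sub_one_le h1
  rw [abs_of_nonneg h0] at h2
  have h3 := (abs_sub_le_iff.1 h2).1
  linarith

/-- `a·b ≦ 2` for `0 ≦ a ≦ 5∕4`, `b ≦ 3∕2`. [cite: Balaban1985Averaging, Prop. 7 p.43, bookkeeping] -/
theorem mul_le_two_of_le {a b : ℝ} (ha0 : 0 ≤ a) (ha : a ≤ 5 / 4) (hb : b ≤ 3 / 2) : a * b ≤ 2 := by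
  nlinarith

/-- `K·y ≦ 1∕c` when `0 ≦ y ≦ 1∕(c·K)`, `K, c > 0`. [cite: Balaban1985Averaging, Prop. 5 p.42, bookkeeping] -/
theorem mul_le_of_le_inv {K c y : ℝ} (hK : 0 < K) (hc : 0 < c) (hy : y ≤ 1 / (c * K)) : K * y ≤ 1 / c := by
  calc K * y ≤ K * (1 / (c * K)) := mul_le_mul_of_nonneg_left hy hK.le
    _ = 1 / c := by field_simp

/-- `X·y ≦ 1∕c` when `0 ≦ X`, `0 ≦ y ≦ 1∕(c·(X+1))`, `c > 0` (no positivity of `X` needed). [cite: Balaban1985Averaging, Prop. 5 p.42, bookkeeping] -/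
theorem mul_le_of_le_inv_succ {X c y : ℝ} (hX : 0 ≤ X) (hc : 0 < c) (hy0 : 0 ≤ y) (hy : y ≤ 1 / (c * (X + 1))) : X * y ≤ 1 / c := by
  have h1 : X * y ≤ (X + 1) * y := by nlinarith
  exact h1.trans (mul_le_of_le_inv (by linarith) hc hy)

/-- `epsCplx` at level `0` is linear in the radius. [cite: Balaban1985Averaging, (139) p.39, bookkeeping] -/
theorem epsCplx_zero_eq (D L : ℕ) (b' : ℝ) : epsCplx D L b' 0 = b' * epsCplx D L 1 0 := by
  unfold epsCplx; simp only [pow_zero, one_mul, mul_one]; ring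

/-- `tauCplx` at levels `0, 0` is bounded by a linear form in `(α₀, b′)` (the factor `L⁻¹ ≦ 1` dropped). [cite: Balaban1985Averaging, (139)–(140) p.39, bookkeeping] -/
theorem tauCplx_zero_le (D L : ℕ) (hL : 1 ≤ L) {α b' : ℝ} (hα : 0 ≤ α) (hb' : 0 ≤ b') :
    tauCplx D L α 0 b' 0 ≤
      ((140 * (32 * ((D : ℝ) + 1) * ((D : ℝ) + 4) * (L : ℝ) ^ 2)) * (L : ℝ) ^ D) * α +
        ((280 * (((2 * (D * L) + L + L : ℕ) : ℝ) * (400 * ((D : ℝ) + 1)))) * (L : ℝ) ^ D) * b' := by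
  have e : tauCplx D L α 0 b' 0 =
      ((140 * (32 * ((D : ℝ) + 1) * ((D : ℝ) + 4) * (L : ℝ) ^ 2 * α)) +
        280 * (((2 * (D * L) + L + L : ℕ) : ℝ) * (400 * ((D : ℝ) + 1) * b'))) * (L : ℝ) ^ D * ((L : ℝ))⁻¹ := by
    unfold tauCplx; simp only [pow_zero, inv_one, mul_one, one_mul, one_pow]
  have hL1 : (1 : ℝ) ≤ (L : ℝ) := by exact_mod_cast hL
  have hLinv : ((L : ℝ))⁻¹ ≤ 1 := inv_le_one_of_one_le₀ hL1
  have hP : 0 ≤ ((140 * (32 * ((D : ℝ) + 1) * ((D : ℝ) + 4) * (L : ℝ) ^ 2 * α)) +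
        280 * (((2 * (D * L) + L + L : ℕ) : ℝ) * (400 * ((D : ℝ) + 1) * b'))) * (L : ℝ) ^ D := by positivity
  rw [e]
  calc _ ≤ (((140 * (32 * ((D : ℝ) + 1) * ((D : ℝ) + 4) * (L : ℝ) ^ 2 * α)) +
        280 * (((2 * (D * L) + L + L : ℕ) : ℝ) * (400 * ((D : ℝ) + 1) * b'))) * (L : ℝ) ^ D) * 1 :=
        mul_le_mul_of_nonneg_left hLinv hP
    _ = _ := by ring

/-! ## §2 ★★ The joint window -/

/-- ★★ **THE JOINT x-FREE NUMERICS WINDOW OF THE KNIT SECT.-B STEP IS NON-EMPTY**: there are `α₀′, a₁, ϱ′, ϱ > 0` with — the knit-letter window: `α₀′ ≦ α_Q(d+1, L)`,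
`C₀(d+1)·α₀′ ≦ 1∕3`, `4α₀′ ≦ c₂′`, `8α₀′ ≦ c₂′`, `K_pl(a)·L⁴ < α₀′` for `0 ≦ a ≦ a₁` at every index; dag-n06-l's Prop.-7 window: `e^{4·800(d+2)²(d+5)α₀′}(1 + 8·131072(d+2)²ϱ′) ≦ 2`,
`2ϱ′ ≦ c₃`, `409600(d+2)²ϱ′ ≦ 1`, `ε(ϱ′) ≦ 1∕16`, `(d+1)(ε(ϱ′) + τ(α₀′, ϱ′)) ≦ 1∕16`, `4096(d+1)ϱ′ ≦ 1` (so `αK := ϱ′` serves the (K1) cap window),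
`e^{4480(d+2)²(d+5)α₀′ + 240000(d+2)³ϱ′}(1 + 8·2097152(d+2)²ϱ) ≦ 2`, `2ϱ ≦ c₃∕4` — i.e. the displayed numerics of `sectBStepUPar_knitRecord` (with `aInv := a₁`) and of
`hclass_C37KY_knit` (with `αK := ϱ′`) hold SIMULTANEOUSLY. [cite: Balaban1985BackgroundPropagators, p.409 («α₀ so small that O(1)Mα₀ is still sufficiently small»), (3.35) p.396; Balaban1985Averaging, Prop. 2 p.26, Prop. 5 p.42, Prop. 7 p.43] -/
theorem knitSectBWindow_inhabited (d ℓ : ℕ) :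
    ∃ α₀' a₁ ϱ' ϱ : ℝ,
      0 < α₀' ∧ α₀' ≤ alphaQ (d + 1) (ℓ + 1) ∧ C0 (d + 1) * α₀' ≤ 1 / 3 ∧ 4 * α₀' ≤ c2' (d + 1) (ℓ + 1) ∧ 8 * α₀' ≤ c2' (d + 1) (ℓ + 1) ∧
      0 < a₁ ∧
      (∀ {hd : 1 ≤ d + 1} {hL : Odd (ℓ + 1) ∧ 1 < ℓ + 1} {b₀ b₁ : ℝ} (i : KIdx d ℓ hd hL b₀ b₁) (a : ℝ), 0 ≤ a → a ≤ a₁ →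
        Kpl i a * (kGeo i).L ^ 4 < α₀') ∧
      0 < ϱ' ∧
      Real.exp (4 * (800 * (((d + 1 : ℕ) : ℝ) + 1) ^ 2 * (((d + 1 : ℕ) : ℝ) + 4)) * α₀')
        * (1 + 8 * (131072 * (((d + 1 : ℕ) : ℝ) + 1) ^ 2) * ϱ') ≤ 2 ∧
      2 * ϱ' ≤ c3 (d + 1) (ℓ + 1) ∧ 409600 * (((d + 1 : ℕ) : ℝ) + 1) ^ 2 * ϱ' ≤ 1 ∧
      epsCplx (d + 1) (ℓ + 1) ϱ' 0 ≤ 1 / 16 ∧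
      ((d + 1 : ℕ) : ℝ) * (epsCplx (d + 1) (ℓ + 1) ϱ' 0 + tauCplx (d + 1) (ℓ + 1) α₀' 0 ϱ' 0) ≤ 1 / 16 ∧
      4096 * ((d + 1 : ℕ) : ℝ) * ϱ' ≤ 1 ∧
      0 < ϱ ∧
      Real.exp (4480 * (((d + 1 : ℕ) : ℝ) + 1) ^ 2 * (((d + 1 : ℕ) : ℝ) + 4) * α₀' + 240000 * (((d + 1 : ℕ) : ℝ) + 1) ^ 3 * ϱ')
        * (1 + 8 * (2097152 * (((d + 1 : ℕ) : ℝ) + 1) ^ 2) * ϱ) ≤ 2 ∧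
      2 * ϱ ≤ c3 (d + 1) (ℓ + 1) / 4 := by
  -- the positive constants
  have hl : 1 ≤ ℓ + 1 := Nat.succ_pos ℓ
  have hD0 : (0 : ℝ) ≤ ((d + 1 : ℕ) : ℝ) := Nat.cast_nonneg _
  have hc2 : 0 < c2' (d + 1) (ℓ + 1) := c2'_pos (d + 1) (ℓ + 1) hl
  have hc3 : 0 < c3 (d + 1) (ℓ + 1) := c3_pos (d + 1) hl
  have hK₁ : (0 : ℝ) < 4 * (800 * (((d + 1 : ℕ) : ℝ) + 1) ^ 2 * (((d + 1 : ℕ) : ℝ) + 4)) := by positivity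
  have hK₂ : (0 : ℝ) < 4480 * (((d + 1 : ℕ) : ℝ) + 1) ^ 2 * (((d + 1 : ℕ) : ℝ) + 4) := by positivity
  have hK₃ : (0 : ℝ) < 240000 * (((d + 1 : ℕ) : ℝ) + 1) ^ 3 := by positivity
  have hF₁ : (0 : ℝ) < 8 * (131072 * (((d + 1 : ℕ) : ℝ) + 1) ^ 2) := by positivity
  have hF₂ : (0 : ℝ) < 8 * (2097152 * (((d + 1 : ℕ) : ℝ) + 1) ^ 2) := by positivity
  have hE₂ : (0 : ℝ) < 409600 * (((d + 1 : ℕ) : ℝ) + 1) ^ 2 := by positivity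
  have hKe : 0 ≤ epsCplx (d + 1) (ℓ + 1) 1 0 := epsCplx_nonneg _ _ zero_le_one _
  set TA : ℝ := (140 * (32 * (((d + 1 : ℕ) : ℝ) + 1) * (((d + 1 : ℕ) : ℝ) + 4) * (((ℓ + 1 : ℕ) : ℝ)) ^ 2)) * (((ℓ + 1 : ℕ) : ℝ)) ^ (d + 1)
    with hTA
  set TB : ℝ := (280 * (((2 * ((d + 1) * (ℓ + 1)) + (ℓ + 1) + (ℓ + 1) : ℕ) : ℝ) * (400 * (((d + 1 : ℕ) : ℝ) + 1)))) * (((ℓ + 1 : ℕ) : ℝ)) ^ (d + 1)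
    with hTB
  have hTA0 : 0 ≤ TA := by rw [hTA]; positivity
  have hTB0 : 0 ≤ TB := by rw [hTB]; positivity
  -- the `α₀′` block from the knit-letter window at a smaller `amax`
  set amax : ℝ := min (min 1 (c2' (d + 1) (ℓ + 1) / 8))
    (min (1 / (8 * (4 * (800 * (((d + 1 : ℕ) : ℝ) + 1) ^ 2 * (((d + 1 : ℕ) : ℝ) + 4)))))
      (min (1 / (16 * (4480 * (((d + 1 : ℕ) : ℝ) + 1) ^ 2 * (((d + 1 : ℕ) : ℝ) + 4))))
        (1 / (48 * (((d + 1 : ℕ) : ℝ) * TA + 1))))) with hamax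
  have hamax0 : 0 < amax := by
    refine lt_min (lt_min one_pos (by positivity)) (lt_min (by positivity) (lt_min (by positivity) (by positivity)))
  obtain ⟨α₀', a₁, hα0, hαle, ha₁, hαQ, hα3, -, hα4, -, -, -, hKpl⟩ := knitWindow_inhabited_le (d := d) (ℓ := ℓ) hamax0
  have hα1 : α₀' ≤ 1 := hαle.trans ((min_le_left _ _).trans (min_le_left _ _))
  have hα8 : α₀' ≤ c2' (d + 1) (ℓ + 1) / 8 := hαle.trans ((min_le_left _ _).trans (min_le_right _ _))
  have hαK₁ : α₀' ≤ 1 / (8 * (4 * (800 * (((d + 1 : ℕ) : ℝ) + 1) ^ 2 * (((d + 1 : ℕ) : ℝ) + 4)))) :=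
    hαle.trans ((min_le_right _ _).trans (min_le_left _ _))
  have hαK₂ : α₀' ≤ 1 / (16 * (4480 * (((d + 1 : ℕ) : ℝ) + 1) ^ 2 * (((d + 1 : ℕ) : ℝ) + 4))) :=
    hαle.trans ((min_le_right _ _).trans ((min_le_right _ _).trans (min_le_left _ _)))
  have hαTA : α₀' ≤ 1 / (48 * (((d + 1 : ℕ) : ℝ) * TA + 1)) :=
    hαle.trans ((min_le_right _ _).trans ((min_le_right _ _).trans (min_le_right _ _)))
  -- the radius `ϱ′`
  set ϱ' : ℝ := min (min (c3 (d + 1) (ℓ + 1) / 2) (1 / (409600 * (((d + 1 : ℕ) : ℝ) + 1) ^ 2)))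
    (min (min (1 / (16 * (epsCplx (d + 1) (ℓ + 1) 1 0 + 1))) (1 / (48 * (((d + 1 : ℕ) : ℝ) * epsCplx (d + 1) (ℓ + 1) 1 0 + 1))))
      (min (1 / (48 * (((d + 1 : ℕ) : ℝ) * TB + 1)))
        (min (1 / (4096 * ((d + 1 : ℕ) : ℝ) + 1))   -- `4096(d+1)ϱ′ ≤ 1` through `X·y ≤ 1` at `X+1`
          (min (1 / (2 * (8 * (131072 * (((d + 1 : ℕ) : ℝ) + 1) ^ 2))))
            (1 / (16 * (240000 * (((d + 1 : ℕ) : ℝ) + 1) ^ 3))))))) with hϱ'def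
  have hϱ'0 : 0 < ϱ' := by
    refine lt_min (lt_min (by positivity) (by positivity)) (lt_min (lt_min (by positivity) (by positivity))
      (lt_min (by positivity) (lt_min (by positivity) (lt_min (by positivity) (by positivity)))))
  have hϱc3 : ϱ' ≤ c3 (d + 1) (ℓ + 1) / 2 := (min_le_left _ _).trans (min_le_left _ _)
  have hϱE₂ : ϱ' ≤ 1 / (409600 * (((d + 1 : ℕ) : ℝ) + 1) ^ 2) := (min_le_left _ _).trans (min_le_right _ _)
  have hϱKe : ϱ' ≤ 1 / (16 * (epsCplx (d + 1) (ℓ + 1) 1 0 + 1)) := (min_le_right _ _).trans ((min_le_left _ _).trans (min_le_left _ _))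
  have hϱDKe : ϱ' ≤ 1 / (48 * (((d + 1 : ℕ) : ℝ) * epsCplx (d + 1) (ℓ + 1) 1 0 + 1)) :=
    (min_le_right _ _).trans ((min_le_left _ _).trans (min_le_right _ _))
  have hϱTB : ϱ' ≤ 1 / (48 * (((d + 1 : ℕ) : ℝ) * TB + 1)) := (min_le_right _ _).trans ((min_le_right _ _).trans (min_le_left _ _))
  have hϱ4096 : ϱ' ≤ 1 / (4096 * ((d + 1 : ℕ) : ℝ) + 1) :=
    (min_le_right _ _).trans ((min_le_right _ _).trans ((min_le_right _ _).trans (min_le_left _ _)))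
  have hϱF₁ : ϱ' ≤ 1 / (2 * (8 * (131072 * (((d + 1 : ℕ) : ℝ) + 1) ^ 2))) :=
    (min_le_right _ _).trans ((min_le_right _ _).trans ((min_le_right _ _).trans ((min_le_right _ _).trans (min_le_left _ _))))
  have hϱK₃ : ϱ' ≤ 1 / (16 * (240000 * (((d + 1 : ℕ) : ℝ) + 1) ^ 3)) :=
    (min_le_right _ _).trans ((min_le_right _ _).trans ((min_le_right _ _).trans ((min_le_right _ _).trans (min_le_right _ _))))
  -- the second radius `ϱ`
  set ϱ : ℝ := min (c3 (d + 1) (ℓ + 1) / 8) (1 / (2 * (8 * (2097152 * (((d + 1 : ℕ) : ℝ) + 1) ^ 2)))) with hϱdef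
  have hϱ0 : 0 < ϱ := lt_min (by positivity) (by positivity)
  -- the exponential factors
  have hexp1 : Real.exp (4 * (800 * (((d + 1 : ℕ) : ℝ) + 1) ^ 2 * (((d + 1 : ℕ) : ℝ) + 4)) * α₀') ≤ 5 / 4 :=
    exp_le_five_fourths (by positivity) (mul_le_of_le_inv hK₁ (by norm_num) hαK₁)
  have hexp2 : Real.exp (4480 * (((d + 1 : ℕ) : ℝ) + 1) ^ 2 * (((d + 1 : ℕ) : ℝ) + 4) * α₀' + 240000 * (((d + 1 : ℕ) : ℝ) + 1) ^ 3 * ϱ') ≤ 5 / 4 := by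
    refine exp_le_five_fourths (by positivity) ?_
    have h1 := mul_le_of_le_inv hK₂ (by norm_num) hαK₂
    have h2 := mul_le_of_le_inv hK₃ (by norm_num) hϱK₃
    linarith
  have hfac1 : 1 + 8 * (131072 * (((d + 1 : ℕ) : ℝ) + 1) ^ 2) * ϱ' ≤ 3 / 2 := by
    have := mul_le_of_le_inv hF₁ (by norm_num) hϱF₁; linarith
  have hfac2 : 1 + 8 * (2097152 * (((d + 1 : ℕ) : ℝ) + 1) ^ 2) * ϱ ≤ 3 / 2 := by
    have := mul_le_of_le_inv hF₂ (by norm_num) (min_le_right _ _ : ϱ ≤ _); linarith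
  -- `ε`, `τ`
  have hε : epsCplx (d + 1) (ℓ + 1) ϱ' 0 = ϱ' * epsCplx (d + 1) (ℓ + 1) 1 0 := epsCplx_zero_eq _ _ _
  have hε16 : epsCplx (d + 1) (ℓ + 1) ϱ' 0 ≤ 1 / 16 := by
    rw [hε, mul_comm]; exact mul_le_of_le_inv_succ hKe (by norm_num) hϱ'0.le hϱKe
  have hτ : tauCplx (d + 1) (ℓ + 1) α₀' 0 ϱ' 0 ≤ TA * α₀' + TB * ϱ' := by
    have := tauCplx_zero_le (d + 1) (ℓ + 1) hl hα0.le hϱ'0.le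
    rw [hTA, hTB]; push_cast at this ⊢; exact this
  refine ⟨α₀', a₁, ϱ', ϱ, hα0, hαQ, hα3, hα4, by linarith, ha₁, fun i a ha hale => hKpl i a ha hale, hϱ'0,
    mul_le_two_of_le (Real.exp_nonneg _) hexp1 hfac1, by linarith,
    ?_, hε16, ?_, ?_, hϱ0, mul_le_two_of_le (Real.exp_nonneg _) hexp2 hfac2, ?_⟩
  · -- `409600(d+2)²ϱ′ ≤ 1`
    have h1 : ϱ' ≤ 1 / (1 * (409600 * (((d + 1 : ℕ) : ℝ) + 1) ^ 2)) := by rw [one_mul]; exact hϱE₂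
    have := mul_le_of_le_inv hE₂ one_pos h1
    rw [one_div_one] at this
    exact this
  · -- `(d+1)(ε + τ) ≤ 1/16`
    have h1 : ((d + 1 : ℕ) : ℝ) * epsCplx (d + 1) (ℓ + 1) ϱ' 0 ≤ 1 / 48 := by
      rw [hε, ← mul_assoc, mul_comm (((d + 1 : ℕ) : ℝ)), mul_assoc, mul_comm]
      exact mul_le_of_le_inv_succ (mul_nonneg hD0 hKe) (by norm_num) hϱ'0.le hϱDKe
    have h2 : ((d + 1 : ℕ) : ℝ) * (TA * α₀') ≤ 1 / 48 := by
      rw [← mul_assoc]; exact mul_le_of_le_inv_succ (mul_nonneg hD0 hTA0) (by norm_num) hα0.le hαTA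
    have h3 : ((d + 1 : ℕ) : ℝ) * (TB * ϱ') ≤ 1 / 48 := by
      rw [← mul_assoc]; exact mul_le_of_le_inv_succ (mul_nonneg hD0 hTB0) (by norm_num) hϱ'0.le hϱTB
    have h4 : ((d + 1 : ℕ) : ℝ) * tauCplx (d + 1) (ℓ + 1) α₀' 0 ϱ' 0 ≤ ((d + 1 : ℕ) : ℝ) * (TA * α₀' + TB * ϱ') :=
      mul_le_mul_of_nonneg_left hτ hD0
    have e1 : ((d + 1 : ℕ) : ℝ) * (epsCplx (d + 1) (ℓ + 1) ϱ' 0 + tauCplx (d + 1) (ℓ + 1) α₀' 0 ϱ' 0) =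
        ((d + 1 : ℕ) : ℝ) * epsCplx (d + 1) (ℓ + 1) ϱ' 0 + ((d + 1 : ℕ) : ℝ) * tauCplx (d + 1) (ℓ + 1) α₀' 0 ϱ' 0 := mul_add _ _ _
    have e2 : ((d + 1 : ℕ) : ℝ) * (TA * α₀' + TB * ϱ') = ((d + 1 : ℕ) : ℝ) * (TA * α₀') + ((d + 1 : ℕ) : ℝ) * (TB * ϱ') := mul_add _ _ _
    rw [e1]
    linarith
  · -- `4096(d+1)ϱ′ ≤ 1`
    have h1 : ϱ' ≤ 1 / (1 * (4096 * ((d + 1 : ℕ) : ℝ) + 1)) := by rw [one_mul]; exact hϱ4096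
    have := mul_le_of_le_inv_succ (show (0 : ℝ) ≤ 4096 * ((d + 1 : ℕ) : ℝ) by positivity) one_pos hϱ'0.le h1
    rw [one_div_one] at this
    exact this
  · -- `2ϱ ≤ c₃/4`
    have : ϱ ≤ c3 (d + 1) (ℓ + 1) / 8 := min_le_left _ _
    linarith

/-! ## §3 (edition 2, «K2-G-KNIT-N») The window below any cap; the joint window with the two `N`-windows -/
/-- ★★ **THE JOINT WINDOW BELOW ANY CAP `amax₀ > 0`** (edition 2, «K2-G-KNIT-N»): the tuple of `knitSectBWindow_inhabited` can be chosen with `α₀′ ≦ amax₀` — the same proof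
with `amax₀` joined to the `min` (`K_pl(a)·L⁴ < α₀′` is re-balanced through `a₁` by `knitWindow_inhabited_le`). [cite: Balaban1985BackgroundPropagators, p.409 («α₀ so small …»), (3.35) p.396; Balaban1985Averaging, Prop. 2 p.26, Prop. 5 p.42, Prop. 7 p.43] -/
theorem knitSectBWindow_inhabited_le (d ℓ : ℕ) {amax₀ : ℝ} (hamax₀ : 0 < amax₀) :
    ∃ α₀' a₁ ϱ' ϱ : ℝ,
      0 < α₀' ∧ α₀' ≤ amax₀ ∧ α₀' ≤ alphaQ (d + 1) (ℓ + 1) ∧ C0 (d + 1) * α₀' ≤ 1 / 3 ∧ 4 * α₀' ≤ c2' (d + 1) (ℓ + 1) ∧ 8 * α₀' ≤ c2' (d + 1) (ℓ + 1) ∧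
      0 < a₁ ∧
      (∀ {hd : 1 ≤ d + 1} {hL : Odd (ℓ + 1) ∧ 1 < ℓ + 1} {b₀ b₁ : ℝ} (i : KIdx d ℓ hd hL b₀ b₁) (a : ℝ), 0 ≤ a → a ≤ a₁ →
        Kpl i a * (kGeo i).L ^ 4 < α₀') ∧
      0 < ϱ' ∧
      Real.exp (4 * (800 * (((d + 1 : ℕ) : ℝ) + 1) ^ 2 * (((d + 1 : ℕ) : ℝ) + 4)) * α₀')
        * (1 + 8 * (131072 * (((d + 1 : ℕ) : ℝ) + 1) ^ 2) * ϱ') ≤ 2 ∧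
      2 * ϱ' ≤ c3 (d + 1) (ℓ + 1) ∧ 409600 * (((d + 1 : ℕ) : ℝ) + 1) ^ 2 * ϱ' ≤ 1 ∧
      epsCplx (d + 1) (ℓ + 1) ϱ' 0 ≤ 1 / 16 ∧
      ((d + 1 : ℕ) : ℝ) * (epsCplx (d + 1) (ℓ + 1) ϱ' 0 + tauCplx (d + 1) (ℓ + 1) α₀' 0 ϱ' 0) ≤ 1 / 16 ∧
      4096 * ((d + 1 : ℕ) : ℝ) * ϱ' ≤ 1 ∧
      0 < ϱ ∧
      Real.exp (4480 * (((d + 1 : ℕ) : ℝ) + 1) ^ 2 * (((d + 1 : ℕ) : ℝ) + 4) * α₀' + 240000 * (((d + 1 : ℕ) : ℝ) + 1) ^ 3 * ϱ')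
        * (1 + 8 * (2097152 * (((d + 1 : ℕ) : ℝ) + 1) ^ 2) * ϱ) ≤ 2 ∧
      2 * ϱ ≤ c3 (d + 1) (ℓ + 1) / 4 := by
  -- the positive constants
  have hl : 1 ≤ ℓ + 1 := Nat.succ_pos ℓ
  have hD0 : (0 : ℝ) ≤ ((d + 1 : ℕ) : ℝ) := Nat.cast_nonneg _
  have hc2 : 0 < c2' (d + 1) (ℓ + 1) := c2'_pos (d + 1) (ℓ + 1) hl
  have hc3 : 0 < c3 (d + 1) (ℓ + 1) := c3_pos (d + 1) hl
  have hK₁ : (0 : ℝ) < 4 * (800 * (((d + 1 : ℕ) : ℝ) + 1) ^ 2 * (((d + 1 : ℕ) : ℝ) + 4)) := by positivity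
  have hK₂ : (0 : ℝ) < 4480 * (((d + 1 : ℕ) : ℝ) + 1) ^ 2 * (((d + 1 : ℕ) : ℝ) + 4) := by positivity
  have hK₃ : (0 : ℝ) < 240000 * (((d + 1 : ℕ) : ℝ) + 1) ^ 3 := by positivity
  have hF₁ : (0 : ℝ) < 8 * (131072 * (((d + 1 : ℕ) : ℝ) + 1) ^ 2) := by positivity
  have hF₂ : (0 : ℝ) < 8 * (2097152 * (((d + 1 : ℕ) : ℝ) + 1) ^ 2) := by positivity
  have hE₂ : (0 : ℝ) < 409600 * (((d + 1 : ℕ) : ℝ) + 1) ^ 2 := by positivity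
  have hKe : 0 ≤ epsCplx (d + 1) (ℓ + 1) 1 0 := epsCplx_nonneg _ _ zero_le_one _
  set TA : ℝ := (140 * (32 * (((d + 1 : ℕ) : ℝ) + 1) * (((d + 1 : ℕ) : ℝ) + 4) * (((ℓ + 1 : ℕ) : ℝ)) ^ 2)) * (((ℓ + 1 : ℕ) : ℝ)) ^ (d + 1)
    with hTA
  set TB : ℝ := (280 * (((2 * ((d + 1) * (ℓ + 1)) + (ℓ + 1) + (ℓ + 1) : ℕ) : ℝ) * (400 * (((d + 1 : ℕ) : ℝ) + 1)))) * (((ℓ + 1 : ℕ) : ℝ)) ^ (d + 1)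
    with hTB
  have hTA0 : 0 ≤ TA := by rw [hTA]; positivity
  have hTB0 : 0 ≤ TB := by rw [hTB]; positivity
  -- the `α₀′` block from the knit-letter window at a smaller `amax`
  set amax : ℝ := min amax₀ (min (min 1 (c2' (d + 1) (ℓ + 1) / 8))
    (min (1 / (8 * (4 * (800 * (((d + 1 : ℕ) : ℝ) + 1) ^ 2 * (((d + 1 : ℕ) : ℝ) + 4)))))
      (min (1 / (16 * (4480 * (((d + 1 : ℕ) : ℝ) + 1) ^ 2 * (((d + 1 : ℕ) : ℝ) + 4))))
        (1 / (48 * (((d + 1 : ℕ) : ℝ) * TA + 1)))))) with hamax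
  have hamax0 : 0 < amax := by
    refine lt_min hamax₀ (lt_min (lt_min one_pos (by positivity)) (lt_min (by positivity) (lt_min (by positivity) (by positivity))))
  obtain ⟨α₀', a₁, hα0, hαle, ha₁, hαQ, hα3, -, hα4, -, -, -, hKpl⟩ := knitWindow_inhabited_le (d := d) (ℓ := ℓ) hamax0
  have hαA : α₀' ≤ amax₀ := hαle.trans (min_le_left _ _)
  have hα1 : α₀' ≤ 1 := (hαle.trans (min_le_right _ _)).trans ((min_le_left _ _).trans (min_le_left _ _))
  have hα8 : α₀' ≤ c2' (d + 1) (ℓ + 1) / 8 := (hαle.trans (min_le_right _ _)).trans ((min_le_left _ _).trans (min_le_right _ _))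
  have hαK₁ : α₀' ≤ 1 / (8 * (4 * (800 * (((d + 1 : ℕ) : ℝ) + 1) ^ 2 * (((d + 1 : ℕ) : ℝ) + 4)))) :=
    (hαle.trans (min_le_right _ _)).trans ((min_le_right _ _).trans (min_le_left _ _))
  have hαK₂ : α₀' ≤ 1 / (16 * (4480 * (((d + 1 : ℕ) : ℝ) + 1) ^ 2 * (((d + 1 : ℕ) : ℝ) + 4))) :=
    (hαle.trans (min_le_right _ _)).trans ((min_le_right _ _).trans ((min_le_right _ _).trans (min_le_left _ _)))
  have hαTA : α₀' ≤ 1 / (48 * (((d + 1 : ℕ) : ℝ) * TA + 1)) :=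
    (hαle.trans (min_le_right _ _)).trans ((min_le_right _ _).trans ((min_le_right _ _).trans (min_le_right _ _)))
  -- the radius `ϱ′`
  set ϱ' : ℝ := min (min (c3 (d + 1) (ℓ + 1) / 2) (1 / (409600 * (((d + 1 : ℕ) : ℝ) + 1) ^ 2)))
    (min (min (1 / (16 * (epsCplx (d + 1) (ℓ + 1) 1 0 + 1))) (1 / (48 * (((d + 1 : ℕ) : ℝ) * epsCplx (d + 1) (ℓ + 1) 1 0 + 1))))
      (min (1 / (48 * (((d + 1 : ℕ) : ℝ) * TB + 1)))
        (min (1 / (4096 * ((d + 1 : ℕ) : ℝ) + 1))   -- `4096(d+1)ϱ′ ≤ 1` through `X·y ≤ 1` at `X+1`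
          (min (1 / (2 * (8 * (131072 * (((d + 1 : ℕ) : ℝ) + 1) ^ 2))))
            (1 / (16 * (240000 * (((d + 1 : ℕ) : ℝ) + 1) ^ 3))))))) with hϱ'def
  have hϱ'0 : 0 < ϱ' := by
    refine lt_min (lt_min (by positivity) (by positivity)) (lt_min (lt_min (by positivity) (by positivity))
      (lt_min (by positivity) (lt_min (by positivity) (lt_min (by positivity) (by positivity)))))
  have hϱc3 : ϱ' ≤ c3 (d + 1) (ℓ + 1) / 2 := (min_le_left _ _).trans (min_le_left _ _)
  have hϱE₂ : ϱ' ≤ 1 / (409600 * (((d + 1 : ℕ) : ℝ) + 1) ^ 2) := (min_le_left _ _).trans (min_le_right _ _)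
  have hϱKe : ϱ' ≤ 1 / (16 * (epsCplx (d + 1) (ℓ + 1) 1 0 + 1)) := (min_le_right _ _).trans ((min_le_left _ _).trans (min_le_left _ _))
  have hϱDKe : ϱ' ≤ 1 / (48 * (((d + 1 : ℕ) : ℝ) * epsCplx (d + 1) (ℓ + 1) 1 0 + 1)) :=
    (min_le_right _ _).trans ((min_le_left _ _).trans (min_le_right _ _))
  have hϱTB : ϱ' ≤ 1 / (48 * (((d + 1 : ℕ) : ℝ) * TB + 1)) := (min_le_right _ _).trans ((min_le_right _ _).trans (min_le_left _ _))
  have hϱ4096 : ϱ' ≤ 1 / (4096 * ((d + 1 : ℕ) : ℝ) + 1) :=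
    (min_le_right _ _).trans ((min_le_right _ _).trans ((min_le_right _ _).trans (min_le_left _ _)))
  have hϱF₁ : ϱ' ≤ 1 / (2 * (8 * (131072 * (((d + 1 : ℕ) : ℝ) + 1) ^ 2))) :=
    (min_le_right _ _).trans ((min_le_right _ _).trans ((min_le_right _ _).trans ((min_le_right _ _).trans (min_le_left _ _))))
  have hϱK₃ : ϱ' ≤ 1 / (16 * (240000 * (((d + 1 : ℕ) : ℝ) + 1) ^ 3)) :=
    (min_le_right _ _).trans ((min_le_right _ _).trans ((min_le_right _ _).trans ((min_le_right _ _).trans (min_le_right _ _))))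
  -- the second radius `ϱ`
  set ϱ : ℝ := min (c3 (d + 1) (ℓ + 1) / 8) (1 / (2 * (8 * (2097152 * (((d + 1 : ℕ) : ℝ) + 1) ^ 2)))) with hϱdef
  have hϱ0 : 0 < ϱ := lt_min (by positivity) (by positivity)
  -- the exponential factors
  have hexp1 : Real.exp (4 * (800 * (((d + 1 : ℕ) : ℝ) + 1) ^ 2 * (((d + 1 : ℕ) : ℝ) + 4)) * α₀') ≤ 5 / 4 :=
    exp_le_five_fourths (by positivity) (mul_le_of_le_inv hK₁ (by norm_num) hαK₁)
  have hexp2 : Real.exp (4480 * (((d + 1 : ℕ) : ℝ) + 1) ^ 2 * (((d + 1 : ℕ) : ℝ) + 4) * α₀' + 240000 * (((d + 1 : ℕ) : ℝ) + 1) ^ 3 * ϱ') ≤ 5 / 4 := by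
    refine exp_le_five_fourths (by positivity) ?_
    have h1 := mul_le_of_le_inv hK₂ (by norm_num) hαK₂
    have h2 := mul_le_of_le_inv hK₃ (by norm_num) hϱK₃
    linarith
  have hfac1 : 1 + 8 * (131072 * (((d + 1 : ℕ) : ℝ) + 1) ^ 2) * ϱ' ≤ 3 / 2 := by
    have := mul_le_of_le_inv hF₁ (by norm_num) hϱF₁; linarith
  have hfac2 : 1 + 8 * (2097152 * (((d + 1 : ℕ) : ℝ) + 1) ^ 2) * ϱ ≤ 3 / 2 := by
    have := mul_le_of_le_inv hF₂ (by norm_num) (min_le_right _ _ : ϱ ≤ _); linarith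
  -- `ε`, `τ`
  have hε : epsCplx (d + 1) (ℓ + 1) ϱ' 0 = ϱ' * epsCplx (d + 1) (ℓ + 1) 1 0 := epsCplx_zero_eq _ _ _
  have hε16 : epsCplx (d + 1) (ℓ + 1) ϱ' 0 ≤ 1 / 16 := by
    rw [hε, mul_comm]; exact mul_le_of_le_inv_succ hKe (by norm_num) hϱ'0.le hϱKe
  have hτ : tauCplx (d + 1) (ℓ + 1) α₀' 0 ϱ' 0 ≤ TA * α₀' + TB * ϱ' := by
    have := tauCplx_zero_le (d + 1) (ℓ + 1) hl hα0.le hϱ'0.le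
    rw [hTA, hTB]; push_cast at this ⊢; exact this
  refine ⟨α₀', a₁, ϱ', ϱ, hα0, hαA, hαQ, hα3, hα4, by linarith, ha₁, fun i a ha hale => hKpl i a ha hale, hϱ'0,
    mul_le_two_of_le (Real.exp_nonneg _) hexp1 hfac1, by linarith,
    ?_, hε16, ?_, ?_, hϱ0, mul_le_two_of_le (Real.exp_nonneg _) hexp2 hfac2, ?_⟩
  · -- `409600(d+2)²ϱ′ ≤ 1`
    have h1 : ϱ' ≤ 1 / (1 * (409600 * (((d + 1 : ℕ) : ℝ) + 1) ^ 2)) := by rw [one_mul]; exact hϱE₂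
    have := mul_le_of_le_inv hE₂ one_pos h1
    rw [one_div_one] at this
    exact this
  · -- `(d+1)(ε + τ) ≤ 1/16`
    have h1 : ((d + 1 : ℕ) : ℝ) * epsCplx (d + 1) (ℓ + 1) ϱ' 0 ≤ 1 / 48 := by
      rw [hε, ← mul_assoc, mul_comm (((d + 1 : ℕ) : ℝ)), mul_assoc, mul_comm]
      exact mul_le_of_le_inv_succ (mul_nonneg hD0 hKe) (by norm_num) hϱ'0.le hϱDKe
    have h2 : ((d + 1 : ℕ) : ℝ) * (TA * α₀') ≤ 1 / 48 := by
      rw [← mul_assoc]; exact mul_le_of_le_inv_succ (mul_nonneg hD0 hTA0) (by norm_num) hα0.le hαTA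
    have h3 : ((d + 1 : ℕ) : ℝ) * (TB * ϱ') ≤ 1 / 48 := by
      rw [← mul_assoc]; exact mul_le_of_le_inv_succ (mul_nonneg hD0 hTB0) (by norm_num) hϱ'0.le hϱTB
    have h4 : ((d + 1 : ℕ) : ℝ) * tauCplx (d + 1) (ℓ + 1) α₀' 0 ϱ' 0 ≤ ((d + 1 : ℕ) : ℝ) * (TA * α₀' + TB * ϱ') :=
      mul_le_mul_of_nonneg_left hτ hD0
    have e1 : ((d + 1 : ℕ) : ℝ) * (epsCplx (d + 1) (ℓ + 1) ϱ' 0 + tauCplx (d + 1) (ℓ + 1) α₀' 0 ϱ' 0) =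
        ((d + 1 : ℕ) : ℝ) * epsCplx (d + 1) (ℓ + 1) ϱ' 0 + ((d + 1 : ℕ) : ℝ) * tauCplx (d + 1) (ℓ + 1) α₀' 0 ϱ' 0 := mul_add _ _ _
    have e2 : ((d + 1 : ℕ) : ℝ) * (TA * α₀' + TB * ϱ') = ((d + 1 : ℕ) : ℝ) * (TA * α₀') + ((d + 1 : ℕ) : ℝ) * (TB * ϱ') := mul_add _ _ _
    rw [e1]
    linarith
  · -- `4096(d+1)ϱ′ ≤ 1`
    have h1 : ϱ' ≤ 1 / (1 * (4096 * ((d + 1 : ℕ) : ℝ) + 1)) := by rw [one_mul]; exact hϱ4096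
    have := mul_le_of_le_inv_succ (show (0 : ℝ) ≤ 4096 * ((d + 1 : ℕ) : ℝ) by positivity) one_pos hϱ'0.le h1
    rw [one_div_one] at this
    exact this
  · -- `2ϱ ≤ c₃/4`
    have : ϱ ≤ c3 (d + 1) (ℓ + 1) / 8 := min_le_left _ _
    linarith

/-- ★★ **THE JOINT WINDOW WITH dag-n06-l's TWO `N`-WINDOWS, EVERY `N`** («K2-G-KNIT-N»: the displays of `N06SectBStepUParKnitRecordN.sectBStepUPar_knitRecordN` ∕ `…KCN` and of
`N06SectBStepUParKnitAt.hclass_C37KY_knitAt` at `SU(N)` — the list of `knitSectBWindow_inhabited` PLUS `32((d+1)+1)((d+1)+4)(ℓ+1)²α₀′ ≦ 1∕4` and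
`N·(32((d+1)+1)((d+1)+4)(ℓ+1)²α₀′) < π` — hold SIMULTANEOUSLY for every `N`): `knitSectBWindow_inhabited_le` at `amax₀ := 1∕(8(N+1)·32((d+1)+1)((d+1)+4)(ℓ+1)²)`.
[cite: Balaban1985BackgroundPropagators, p.409, (3.35) p.396; Balaban1985Averaging, Prop. 2 p.26 («for SU(N)»), Prop. 7 p.43] -/
theorem knitSectBWindow_inhabited_N (d ℓ N : ℕ) :
    ∃ α₀' a₁ ϱ' ϱ : ℝ,
      0 < α₀' ∧ (32 * (((d + 1 : ℕ) : ℝ) + 1) * ((d + 1 : ℕ) + 4) * (((ℓ + 1 : ℕ) : ℝ)) ^ 2) * α₀' ≤ 1 / 4 ∧ (N : ℝ) * ((32 * (((d + 1 : ℕ) : ℝ) + 1) * ((d + 1 : ℕ) + 4) * (((ℓ + 1 : ℕ) : ℝ)) ^ 2) * α₀') < Real.pi ∧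
      α₀' ≤ alphaQ (d + 1) (ℓ + 1) ∧ C0 (d + 1) * α₀' ≤ 1 / 3 ∧ 4 * α₀' ≤ c2' (d + 1) (ℓ + 1) ∧ 8 * α₀' ≤ c2' (d + 1) (ℓ + 1) ∧
      0 < a₁ ∧
      (∀ {hd : 1 ≤ d + 1} {hL : Odd (ℓ + 1) ∧ 1 < ℓ + 1} {b₀ b₁ : ℝ} (i : KIdx d ℓ hd hL b₀ b₁) (a : ℝ), 0 ≤ a → a ≤ a₁ →
        Kpl i a * (kGeo i).L ^ 4 < α₀') ∧
      0 < ϱ' ∧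
      Real.exp (4 * (800 * (((d + 1 : ℕ) : ℝ) + 1) ^ 2 * (((d + 1 : ℕ) : ℝ) + 4)) * α₀')
        * (1 + 8 * (131072 * (((d + 1 : ℕ) : ℝ) + 1) ^ 2) * ϱ') ≤ 2 ∧
      2 * ϱ' ≤ c3 (d + 1) (ℓ + 1) ∧ 409600 * (((d + 1 : ℕ) : ℝ) + 1) ^ 2 * ϱ' ≤ 1 ∧
      epsCplx (d + 1) (ℓ + 1) ϱ' 0 ≤ 1 / 16 ∧
      ((d + 1 : ℕ) : ℝ) * (epsCplx (d + 1) (ℓ + 1) ϱ' 0 + tauCplx (d + 1) (ℓ + 1) α₀' 0 ϱ' 0) ≤ 1 / 16 ∧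
      4096 * ((d + 1 : ℕ) : ℝ) * ϱ' ≤ 1 ∧
      0 < ϱ ∧
      Real.exp (4480 * (((d + 1 : ℕ) : ℝ) + 1) ^ 2 * (((d + 1 : ℕ) : ℝ) + 4) * α₀' + 240000 * (((d + 1 : ℕ) : ℝ) + 1) ^ 3 * ϱ')
        * (1 + 8 * (2097152 * (((d + 1 : ℕ) : ℝ) + 1) ^ 2) * ϱ) ≤ 2 ∧
      2 * ϱ ≤ c3 (d + 1) (ℓ + 1) / 4 := by
  have hW : (0 : ℝ) < (32 * (((d + 1 : ℕ) : ℝ) + 1) * ((d + 1 : ℕ) + 4) * (((ℓ + 1 : ℕ) : ℝ)) ^ 2) := by positivity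
  have hN1 : (0 : ℝ) < (N : ℝ) + 1 := by positivity
  have hA : (0 : ℝ) < 1 / (8 * ((N : ℝ) + 1) * (32 * (((d + 1 : ℕ) : ℝ) + 1) * ((d + 1 : ℕ) + 4) * (((ℓ + 1 : ℕ) : ℝ)) ^ 2)) := by positivity
  obtain ⟨α₀', a₁, ϱ', ϱ, hα0, hαA, hrest⟩ := knitSectBWindow_inhabited_le d ℓ hA
  refine ⟨α₀', a₁, ϱ', ϱ, hα0, ?_, ?_, hrest⟩
  · -- `W·α₀′ ≤ W∕(8(N+1)W) = 1∕(8(N+1)) ≤ 1∕4`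
    have h1 : (32 * (((d + 1 : ℕ) : ℝ) + 1) * ((d + 1 : ℕ) + 4) * (((ℓ + 1 : ℕ) : ℝ)) ^ 2) * α₀' ≤ (32 * (((d + 1 : ℕ) : ℝ) + 1) * ((d + 1 : ℕ) + 4) * (((ℓ + 1 : ℕ) : ℝ)) ^ 2) * (1 / (8 * ((N : ℝ) + 1) * (32 * (((d + 1 : ℕ) : ℝ) + 1) * ((d + 1 : ℕ) + 4) * (((ℓ + 1 : ℕ) : ℝ)) ^ 2))) := mul_le_mul_of_nonneg_left hαA hW.le
    have h2 : (32 * (((d + 1 : ℕ) : ℝ) + 1) * ((d + 1 : ℕ) + 4) * (((ℓ + 1 : ℕ) : ℝ)) ^ 2) * (1 / (8 * ((N : ℝ) + 1) * (32 * (((d + 1 : ℕ) : ℝ) + 1) * ((d + 1 : ℕ) + 4) * (((ℓ + 1 : ℕ) : ℝ)) ^ 2))) = 1 / (8 * ((N : ℝ) + 1)) := by field_simp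
    have h3 : 1 / (8 * ((N : ℝ) + 1)) ≤ 1 / 4 := by
      rw [div_le_div_iff₀ (by positivity) (by norm_num)]; nlinarith
    linarith
  · -- `N·W·α₀′ ≤ N∕(8(N+1)) < 1 < π`
    have h1 : (N : ℝ) * ((32 * (((d + 1 : ℕ) : ℝ) + 1) * ((d + 1 : ℕ) + 4) * (((ℓ + 1 : ℕ) : ℝ)) ^ 2) * α₀') ≤ (N : ℝ) * ((32 * (((d + 1 : ℕ) : ℝ) + 1) * ((d + 1 : ℕ) + 4) * (((ℓ + 1 : ℕ) : ℝ)) ^ 2) * (1 / (8 * ((N : ℝ) + 1) * (32 * (((d + 1 : ℕ) : ℝ) + 1) * ((d + 1 : ℕ) + 4) * (((ℓ + 1 : ℕ) : ℝ)) ^ 2)))) :=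
      mul_le_mul_of_nonneg_left (mul_le_mul_of_nonneg_left hαA hW.le) (Nat.cast_nonneg N)
    have h2 : (N : ℝ) * ((32 * (((d + 1 : ℕ) : ℝ) + 1) * ((d + 1 : ℕ) + 4) * (((ℓ + 1 : ℕ) : ℝ)) ^ 2) * (1 / (8 * ((N : ℝ) + 1) * (32 * (((d + 1 : ℕ) : ℝ) + 1) * ((d + 1 : ℕ) + 4) * (((ℓ + 1 : ℕ) : ℝ)) ^ 2)))) = (N : ℝ) / (8 * ((N : ℝ) + 1)) := by field_simp
    have h3 : (N : ℝ) / (8 * ((N : ℝ) + 1)) < 1 := by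
      rw [div_lt_one (by positivity)]; nlinarith
    linarith [Real.pi_gt_three]

end Summit.QuantumFields.YangMills.BalabanUVNodes.N06SectBKnitWindow

end
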